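import Summits.PneNP.PneNP.Theorems.SoloInformedPartialMCSP
import Summits.PneNP.PneNP.Theorems.SoloInformedStreamingCeiling
import Literature.Computability.MetaComplexity.McKayMurrayWilliams2019.UniformStreamingFooling
import Literature.Computability.MetaComplexity.MCSPTreeWalk
import Mathlib.Data.Nat.Choose.Central
import HarnessLib

/-! # SoloInformedPartialStreaming — partial `MCSP` at the read-once threshold needs linear one-pass space

Solo informed, generation 10.  The McKay–Murray–Williams door (`StreamingLowerBound`) asks for
lower bounds against `(log₂ N)^c + c`-space one-pass algorithms for TOTAL `MCSP[s]`, where state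
counting is blind: SOME one-pass algorithm (update map arbitrary) decides `MCSP[n]` within
`(log₂ N)^3 + 3` bits (`SoloInformedStreamingCeiling`).  The PARTIAL-function problem at the same
grain is of a different species, by theorem:

* `soloInformed_mcspStar_states` / `_space`: every `StreamingAlgorithm` (init/update/accept maps
  indexed by the input length; no uniformity, no time bound) deciding `MCSP*[n - 2]`
  (`SoloPartial.mcspStarSize (· - 2)`) within `S N` bits of state satisfies
  `binom(2^(k+1), 2^k) ≤ (S N_k + 1) · 2^{S N_k}` at `N_k = 15 · 2^(k+1) + 2` (`k ≥ 1`), hence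
  `2^(k+1) ≤ 2 S(N_k) + k + 1`, i.e. `S(N) ≥ N/30 - log₂ N` at every `N = N_k`: LINEAR space;
* `soloInformed_mcspStar_not_polylog_space` / `_not_mem_USTREAM`: so for every `c` (and every
  update time `T`) `MCSP*[n - 2] ∉ USTREAM[(log₂ N)^c + c, T]` — the partial-function twin of every
  conjunct of the door's hypothesis HOLDS;
* `soloInformed_mcspSize_threshold_polylog`: total `MCSP[n - 2]` IS decided one-pass within
  `(log₂ N)^3 + 3` bits at every length.

Proof: a one-way INDEX embedding.  Arity `k + 2`, threshold `k` gates.  Alice's half of the table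
(last variable `0`) is `⋆` on a `2^k`-set `U` and `0` elsewhere; Bob's half (last variable `1`) is
the indicator of a position `u`.  If `u ∈ U` the point conjunction `[x_{<k+1} = u]` (`k` gates) is
consistent (`word_mem`); if `u ∉ U` every consistent total function depends on all `k + 2`
variables — impossible with `k` binary gates by the light-cone bound of `SoloInformedPartialMCSP`
(`word_not_mem`).  Alice's part is a fixed-length PREFIX of the code, so a decider reaches pairwise
different states on the `binom(2^(k+1), 2^k)` prefixes (`reach_pre_injective`).  Reading for the
door (paper §3(b)): small-space one-pass decidability of `MCSP[s]` is a TOTAL-function phenomenon.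

Landed as new mathematics under the host summit per the tree convention; no Literature fact is
introduced. -/

noncomputable section
namespace Summit.PneNP.PneNP.Theorems
open Finset Computability Literature.Computability.Complexity Literature.Computability.MetaComplexity
open Literature.Computability.MetaComplexity.McKayMurrayWilliams2019

namespace SoloPartial

section Family
variable (k : ℕ)

/-- Code block of one table entry: `none ↦ 0001`, `some b ↦ 11bb01`. -/
def blk (o : Option Bool) : List Bool := boolPair ((encodingBoolBool.optionBool).encode o) []

/-- Body of a list code: the concatenated blocks. -/
def F (l : List (Option Bool)) : List Bool := l.flatMap blk

/-- Alice's half-table (last variable `false`): `⋆` on `U`, `0` elsewhere. -/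
def aliceL (U : Finset (Fin (2 ^ (k + 1)))) : List (Option Bool) :=
  List.ofFn fun i : Fin (2 ^ (k + 1)) => if i ∈ U then none else some false

/-- Bob's half-table (last variable `true`): the indicator of his index `u`. -/
def bobL (u : Fin (2 ^ (k + 1))) : List (Option Bool) :=
  List.ofFn fun i : Fin (2 ^ (k + 1)) => some (decide ((i : ℕ) = (u : ℕ)))

/-- The prefix of the instance: list header and Alice's blocks (depends on `U` only). -/
def pre (U : Finset (Fin (2 ^ (k + 1)))) : List Bool :=
  boolPair (unaryEncodeNat (2 ^ (k + 2))) [] ++ F (aliceL k U)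

/-- The suffix of the instance: Bob's blocks (depends on `u` only). -/
def suf (u : Fin (2 ^ (k + 1))) : List Bool := F (bobL k u)

/-- The partial truth table of the instance `(U, u)` on `k + 2` variables. -/
def tab (U : Finset (Fin (2 ^ (k + 1)))) (u : Fin (2 ^ (k + 1))) :
    Fin (2 ^ (k + 2)) → Option Bool := fun i =>
  if h : (i : ℕ) < 2 ^ (k + 1) then (if (⟨i, h⟩ : Fin (2 ^ (k + 1))) ∈ U then none else some false)
  else some (decide ((i : ℕ) = 2 ^ (k + 1) + u))

/-- The block of a don't-care entry. -/
theorem blk_none : blk none = [false, false, false, true] := rfl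

/-- The block of a defined entry. -/
theorem blk_some (b : Bool) : blk (some b) = [true, true, b, b, false, true] := by cases b <;> rfl

/-- A list code is its unary length header followed by the blocks. -/
theorem encode_eq_append (l : List (Option Bool)) :
    (encodingBoolBool.optionBool).listBool.encode l =
      boolPair (unaryEncodeNat l.length) [] ++ F l := by
  have hF : l.foldr (fun a acc => boolPair ((encodingBoolBool.optionBool).encode a) acc) [] = F l := by
    induction l with
    | nil => rfl
    | cons a l ih => rw [List.foldr_cons, ih]; simp [F, blk, boolPair]
  change boolPair (unaryEncodeNat l.length) (l.foldr _ []) = _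
  rw [hF]; simp [boolPair]

/-- The table of the instance `(U, u)` lists Alice's half, then Bob's half. -/
theorem ofFn_tab (U : Finset (Fin (2 ^ (k + 1)))) (u : Fin (2 ^ (k + 1))) :
    List.ofFn (tab k U u) = aliceL k U ++ bobL k u := by
  have hA : (aliceL k U).length = 2 ^ (k + 1) := by simp [aliceL]
  apply List.ext_getElem
  · simp only [List.length_ofFn, List.length_append, aliceL, bobL, pow_succ]; omega
  · intro i h₁ h₂
    rw [List.getElem_ofFn]
    by_cases h : i < 2 ^ (k + 1)
    · rw [List.getElem_append_left (hA ▸ h)]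
      simp [tab, aliceL, h]
    · rw [List.getElem_append_right (hA ▸ not_lt.1 h)]
      simp only [tab, dif_neg h, bobL, List.getElem_ofFn, hA, Option.some.injEq, decide_eq_decide]
      omega

/-- The instance `(U, u)` is the word `pre U ++ suf u`. -/
theorem word_eq (U : Finset (Fin (2 ^ (k + 1)))) (u : Fin (2 ^ (k + 1))) :
    (encodingBoolBool.optionBool).listBool.encode (List.ofFn (tab k U u)) = pre k U ++ suf k u := by
  rw [encode_eq_append, List.length_ofFn, ofFn_tab]
  simp [F, pre, suf]

/-- Bob's suffix has length `6 · 2^(k+1)`. -/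
theorem length_suf (u : Fin (2 ^ (k + 1))) : (suf k u).length = 6 * 2 ^ (k + 1) := by
  simp [suf, F, bobL, List.length_flatMap, List.map_ofFn, Function.comp_def, blk_some,
    mul_comm]

/-- Alice's blocks have length `5 · 2^(k+1)` when `|U| = 2^k`. -/
theorem length_F_aliceL (U : Finset (Fin (2 ^ (k + 1)))) (hU : U.card = 2 ^ k) :
    (F (aliceL k U)).length = 5 * 2 ^ (k + 1) := by
  have h1 : (F (aliceL k U)).length = ∑ i : Fin (2 ^ (k + 1)), if i ∈ U then 4 else 6 := by
    simp only [F, aliceL, List.length_flatMap, List.map_ofFn, List.sum_ofFn, Function.comp_def]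
    refine Finset.sum_congr rfl fun i _ => ?_
    split_ifs <;> simp [blk_none, blk_some]
  have h2 : (∑ i : Fin (2 ^ (k + 1)), if i ∈ U then (4 : ℕ) else 6) +
      ∑ i : Fin (2 ^ (k + 1)), (if i ∈ U then (2 : ℕ) else 0) = ∑ _i : Fin (2 ^ (k + 1)), (6 : ℕ) := by
    rw [← Finset.sum_add_distrib]
    exact Finset.sum_congr rfl fun i _ => by split_ifs <;> rfl
  rw [Finset.sum_ite_mem, Finset.univ_inter, Finset.sum_const, Finset.sum_const, smul_eq_mul,
    smul_eq_mul, hU, Finset.card_univ, Fintype.card_fin] at h2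
  rw [h1, pow_succ] at *
  omega

/-- The prefix has length `9 · 2^(k+1) + 2` when `|U| = 2^k`. -/
theorem length_pre (U : Finset (Fin (2 ^ (k + 1)))) (hU : U.card = 2 ^ k) :
    (pre k U).length = 9 * 2 ^ (k + 1) + 2 := by
  simp only [pre, List.length_append, length_boolPair, List.length_nil, length_F_aliceL k U hU]
  rw [show (unaryEncodeNat (2 ^ (k + 2))).length = 2 ^ (k + 2) from unary_decode_encode_nat _,
    pow_succ 2 (k + 1)]
  omega

/-- All instances with `|U| = 2^k` have the same length `N_k = 15 · 2^(k+1) + 2`. -/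
theorem length_word (U : Finset (Fin (2 ^ (k + 1)))) (hU : U.card = 2 ^ k) (u : Fin (2 ^ (k + 1))) :
    (pre k U ++ suf k u).length = 15 * 2 ^ (k + 1) + 2 := by
  rw [List.length_append, length_pre k U hU, length_suf]; omega

/-- Two numbers below `2^m` agree iff their `m` low bits agree. -/
theorem testBit_low_iff {m a b : ℕ} (ha : a < 2 ^ m) (hb : b < 2 ^ m) :
    (∀ j : Fin m, a.testBit j = b.testBit j) ↔ a = b := by
  refine ⟨fun h => Nat.eq_of_testBit_eq fun j => ?_, fun h j => h ▸ rfl⟩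
  by_cases hj : j < m
  · exact h ⟨j, hj⟩
  · rw [Nat.testBit_lt_two_pow (ha.trans_le (Nat.pow_le_pow_right two_pos (not_lt.1 hj))),
      Nat.testBit_lt_two_pow (hb.trans_le (Nat.pow_le_pow_right two_pos (not_lt.1 hj)))]

/-- The last variable of a point is bit `k + 1` of its index. -/
theorem testBit_bfe_last (x : Fin (k + 2) → Bool) :
    ((boolFunEquivFin (k + 2) x : Fin _) : ℕ).testBit (k + 1) = x (Fin.last (k + 1)) := by
  have h := boolFunEquivFin_symm_apply_eq_testBit (k + 2) (boolFunEquivFin (k + 2) x)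
    (Fin.last (k + 1))
  rw [Equiv.symm_apply_apply, Fin.val_last] at h
  exact h.symm

/-- The point circuit's literals: `x_j = u_j` for the `k + 1` low variables. -/
def lits (u : Fin (2 ^ (k + 1))) : List (Fin (k + 2) × Bool) :=
  List.ofFn fun j : Fin (k + 1) => (Fin.castSucc j, (u : ℕ).testBit j)

/-- The point circuit accepts exactly the points agreeing with `u` on the low variables. -/
theorem conjL_lits_iff (u : Fin (2 ^ (k + 1))) (i : Fin (2 ^ (k + 2))) :
    conjL (lits k u) ((boolFunEquivFin (k + 2)).symm i) = true ↔
      ∀ j : Fin (k + 1), (i : ℕ).testBit j = (u : ℕ).testBit j := by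
  simp only [conjL_eq_true_iff, lits, List.forall_mem_ofFn_iff,
    boolFunEquivFin_symm_apply_eq_testBit, Fin.val_castSucc]

/-- **Yes**: if Bob's index is a don't-care of Alice, the point function `[x_{<k+1} = u]`
(`k` gates) is consistent with the table. -/
theorem word_mem {U : Finset (Fin (2 ^ (k + 1)))} {u : Fin (2 ^ (k + 1))} (hu : u ∈ U)
    (hk : 1 ≤ k) : pre k U ++ suf k u ∈ mcspStarSize (fun n => n - 2) := by
  rw [← word_eq, encode_mem_mcspStarSize_iff]
  obtain ⟨C, hB, hs, hC⟩ := exists_circuit_conjL (lits k u) (by simp [lits]; omega)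
  refine ⟨C, hB, by simp only [lits, List.length_ofFn] at hs; omega, fun i b hi => ?_⟩
  rw [hC]
  have H2 : (2 : ℕ) ^ (k + 2) = 2 ^ (k + 1) + 2 ^ (k + 1) := by rw [pow_succ]; omega
  by_cases h : (i : ℕ) < 2 ^ (k + 1)
  · simp only [tab, dif_pos h] at hi
    split_ifs at hi with hiU
    cases hi
    rw [Bool.eq_false_iff, ne_eq, conjL_lits_iff, testBit_low_iff h u.2]
    intro hiu
    exact hiU (by rwa [show (⟨(i : ℕ), h⟩ : Fin (2 ^ (k + 1))) = u from Fin.ext hiu])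
  · simp only [tab, dif_neg h, Option.some.injEq] at hi
    subst hi
    obtain ⟨r, hr⟩ : ∃ r, (i : ℕ) = 2 ^ (k + 1) + r := ⟨i - 2 ^ (k + 1), by omega⟩
    have hr' : r < 2 ^ (k + 1) := by have := i.2; omega
    apply Bool.eq_iff_iff.2
    rw [conjL_lits_iff, decide_eq_true_iff, hr]
    simp only [Nat.testBit_two_pow_add_gt, Fin.is_lt]
    rw [testBit_low_iff hr' u.2]
    omega

/-- **No**: if Bob's index is a `0` of Alice, every consistent circuit depends on all `k + 2`
variables, so has at least `k + 1` gates. -/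
theorem word_not_mem {U : Finset (Fin (2 ^ (k + 1)))} {u : Fin (2 ^ (k + 1))} (hu : u ∉ U) :
    pre k U ++ suf k u ∉ mcspStarSize (fun n => n - 2) := by
  rw [← word_eq, encode_mem_mcspStarSize_iff]
  rintro ⟨C, hB, hs, hC⟩
  obtain ⟨j, hj⟩ := exists_forall_update_eq C hB (by omega)
  have H2 : (2 : ℕ) ^ (k + 2) = 2 ^ (k + 1) + 2 ^ (k + 1) := by rw [pow_succ]; omega
  have hHu : 2 ^ (k + 1) + (u : ℕ) < 2 ^ (k + 2) := by omega
  have huH : (u : ℕ) < 2 ^ (k + 2) := by omega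
  have hBob : C.eval ((boolFunEquivFin (k + 2)).symm ⟨_, hHu⟩) = true :=
    hC ⟨_, hHu⟩ true (by simp [tab])
  have hAlice : C.eval ((boolFunEquivFin (k + 2)).symm ⟨u, huH⟩) = false :=
    hC ⟨u, huH⟩ false (by simp [tab, hu])
  have hOff : ∀ i : Fin (2 ^ (k + 2)), ¬ ((i : ℕ) < 2 ^ (k + 1)) → (i : ℕ) ≠ 2 ^ (k + 1) + u →
      C.eval ((boolFunEquivFin (k + 2)).symm i) = false :=
    fun i h1 h2 => hC i false (by simp [tab, h1, h2])
  have hlast : (boolFunEquivFin (k + 2)).symm ⟨_, hHu⟩ (Fin.last (k + 1)) = true := by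
    rw [boolFunEquivFin_symm_apply_eq_testBit, Fin.val_last, Nat.testBit_two_pow_add_eq,
      Nat.testBit_lt_two_pow u.2]
    rfl
  rcases Fin.eq_castSucc_or_eq_last j with ⟨j₀, rfl⟩ | rfl
  · -- flip the irrelevant low variable `x_{j₀}` of Bob's point: an off-diagonal `0` of Bob
    have hβ := hj ((boolFunEquivFin (k + 2)).symm ⟨_, hHu⟩)
      (!(boolFunEquivFin (k + 2)).symm ⟨_, hHu⟩ (Fin.castSucc j₀))
    rw [hBob] at hβ
    have h3 := hOff (boolFunEquivFin (k + 2) (Function.update ((boolFunEquivFin (k + 2)).symm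
      ⟨_, hHu⟩) (Fin.castSucc j₀) (!(boolFunEquivFin (k + 2)).symm ⟨_, hHu⟩ (Fin.castSucc j₀))))
      ?_ ?_
    · rw [Equiv.symm_apply_apply, hβ] at h3
      exact Bool.false_ne_true h3.symm
    · intro hlt
      have h4 := testBit_bfe_last k (Function.update ((boolFunEquivFin (k + 2)).symm ⟨_, hHu⟩)
        (Fin.castSucc j₀) (!(boolFunEquivFin (k + 2)).symm ⟨_, hHu⟩ (Fin.castSucc j₀)))
      rw [Function.update_of_ne (Fin.castSucc_lt_last j₀).ne', hlast,
        Nat.testBit_lt_two_pow hlt] at h4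
      exact Bool.false_ne_true h4
    · intro heq
      have h5 : Function.update ((boolFunEquivFin (k + 2)).symm ⟨_, hHu⟩) (Fin.castSucc j₀)
          (!(boolFunEquivFin (k + 2)).symm ⟨_, hHu⟩ (Fin.castSucc j₀)) =
          (boolFunEquivFin (k + 2)).symm ⟨_, hHu⟩ := by
        rw [← Equiv.apply_eq_iff_eq_symm_apply]
        exact Fin.ext heq
      have h6 := congrFun h5 (Fin.castSucc j₀)
      rw [Function.update_self] at h6
      exact Bool.not_ne_self _ h6
  · -- drop the irrelevant last variable of Bob's point: Alice's `0` at `u`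
    have hβ := hj ((boolFunEquivFin (k + 2)).symm ⟨_, hHu⟩) false
    have heq : Function.update ((boolFunEquivFin (k + 2)).symm ⟨_, hHu⟩) (Fin.last (k + 1)) false =
        (boolFunEquivFin (k + 2)).symm ⟨u, huH⟩ := by
      funext j'
      rcases Fin.eq_castSucc_or_eq_last j' with ⟨j₁, rfl⟩ | rfl
      · rw [Function.update_of_ne (Fin.castSucc_lt_last j₁).ne, boolFunEquivFin_symm_apply_eq_testBit,
          boolFunEquivFin_symm_apply_eq_testBit, Fin.val_castSucc, Nat.testBit_two_pow_add_gt j₁.2]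
      · rw [Function.update_self, boolFunEquivFin_symm_apply_eq_testBit, Fin.val_last,
          Nat.testBit_lt_two_pow u.2]
    rw [heq, hBob, hAlice] at hβ
    exact Bool.false_ne_true hβ

/-- Same state after two prefixes, same verdict on a common suffix (one pass). -/
theorem accepts_iff_of_reach_eq (A : StreamingAlgorithm) {N : ℕ} {p p' v : List Bool}
    (hp : (p ++ v).length = N) (hp' : (p' ++ v).length = N) (h : reach A N p = reach A N p') :
    A.Accepts (p ++ v) ↔ A.Accepts (p' ++ v) := by
  unfold StreamingAlgorithm.Accepts
  rw [hp, hp', finalState_append A _ _ hp, finalState_append A _ _ hp', h]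

/-- INDEX: a decider must reach pairwise different states on the `binom(2^(k+1), 2^k)` prefixes. -/
theorem reach_pre_injective (A : StreamingAlgorithm) (hD : A.Decides (mcspStarSize fun n => n - 2))
    (hk : 1 ≤ k) :
    Function.Injective fun U : {U : Finset (Fin (2 ^ (k + 1))) // U.card = 2 ^ k} =>
      reach A (15 * 2 ^ (k + 1) + 2) (pre k U.1) := by
  intro U U' h
  by_contra hne
  have hne' : U.1 ≠ U'.1 := fun h' => hne (Subtype.ext h')
  have hns : ¬ U.1 ⊆ U'.1 := fun hsub =>
    hne' (Finset.eq_of_subset_of_card_le hsub (by rw [U.2, U'.2]))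
  obtain ⟨u, huU, huU'⟩ := Finset.not_subset.1 hns
  have hacc := accepts_iff_of_reach_eq A (length_word k U.1 U.2 u) (length_word k U'.1 U'.2 u) h
  exact word_not_mem k huU' ((hD _).1 (hacc.1 ((hD _).2 (word_mem k huU hk))))

/-- The index set of the prefixes: `2^k`-subsets of Alice's `2^(k+1)` positions. -/
abbrev Idx : Type := {U : Finset (Fin (2 ^ (k + 1))) // U.card = 2 ^ k}

/-- Few states: the reached states on the prefixes number at most `(S N_k + 1) · 2^{S N_k}`. -/
theorem card_image_reach_pre_le (A : StreamingAlgorithm) {S : ℕ → ℕ} (hS : RunsInSpace A S) :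
    ((univ : Finset (Idx k)).image fun U => reach A (15 * 2 ^ (k + 1) + 2) (pre k U.1)).card ≤
      (S (15 * 2 ^ (k + 1) + 2) + 1) * 2 ^ S (15 * 2 ^ (k + 1) + 2) :=
  card_image_reach_le A hS (N := 15 * 2 ^ (k + 1) + 2) univ (fun U : Idx k => pre k U.1)
    fun U => by rw [length_pre k U.1 U.2]; omega

end Family

end SoloPartial

open SoloPartial

/-- **Partial MCSP at the read-once threshold needs linearly many streaming states**: a one-pass
decider of `MCSP*[n - 2]` in space `S` reaches `≥ binom(2^(k+1), 2^k)` states at `N_k = 15·2^(k+1)+2`. -/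
theorem soloInformed_mcspStar_states (A : StreamingAlgorithm) {S : ℕ → ℕ} (hS : RunsInSpace A S)
    (hD : A.Decides (mcspStarSize fun n => n - 2)) {k : ℕ} (hk : 1 ≤ k) :
    Nat.centralBinom (2 ^ k) ≤ (S (15 * 2 ^ (k + 1) + 2) + 1) * 2 ^ S (15 * 2 ^ (k + 1) + 2) := by
  calc Nat.centralBinom (2 ^ k) = (univ : Finset (Idx k)).card := by
        rw [Finset.card_univ, Fintype.card_finset_len, Fintype.card_fin, Nat.centralBinom, pow_succ']
    _ = ((univ : Finset (Idx k)).image fun U => reach A (15 * 2 ^ (k + 1) + 2) (pre k U.1)).card :=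
        (Finset.card_image_of_injective _ (reach_pre_injective k A hD hk)).symm
    _ ≤ _ := card_image_reach_pre_le k A hS

/-- **Corollary: linear space.** In the notation above, `2^(k+1) ≤ 2 · S(N_k) + k + 1`, i.e.
`S(N_k) ≥ (N_k - 2) / 30 - (log₂ N_k) / 2`. -/
theorem soloInformed_mcspStar_space (A : StreamingAlgorithm) {S : ℕ → ℕ} (hS : RunsInSpace A S)
    (hD : A.Decides (mcspStarSize fun n => n - 2)) {k : ℕ} (hk : 1 ≤ k) :
    2 ^ (k + 1) ≤ 2 * S (15 * 2 ^ (k + 1) + 2) + k + 1 := by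
  have h := soloInformed_mcspStar_states A hS hD hk
  set s := S (15 * 2 ^ (k + 1) + 2)
  have hs1 : s + 1 ≤ 2 ^ s := Nat.lt_two_pow_self
  have h2 : (2 : ℕ) ^ 2 ^ (k + 1) ≤ 2 ^ (k + 1 + (s + s)) :=
    calc (2 : ℕ) ^ 2 ^ (k + 1) = 4 ^ 2 ^ k := by rw [pow_succ', pow_mul]; norm_num
      _ ≤ 2 * 2 ^ k * Nat.centralBinom (2 ^ k) :=
        Nat.four_pow_le_two_mul_self_mul_centralBinom _ (by positivity)
      _ ≤ 2 * 2 ^ k * ((s + 1) * 2 ^ s) := Nat.mul_le_mul_left _ h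
      _ ≤ 2 * 2 ^ k * (2 ^ s * 2 ^ s) := Nat.mul_le_mul_left _ (Nat.mul_le_mul_right _ hs1)
      _ = 2 ^ (k + 1 + (s + s)) := by ring
  have h3 := (Nat.pow_le_pow_iff_right (by norm_num : 1 < 2)).1 h2
  omega

/-- Polynomials in `k` are eventually below `2^k`: the door's budget `(log₂ N)^c + c` is
sublinear along the family's lengths `N_k`. -/
theorem exists_two_mul_pow_lt (c : ℕ) :
    ∃ K, ∀ k, K ≤ k → 2 * ((k + 5) ^ c + c) + k + 1 < 2 ^ (k + 1) := by
  obtain ⟨K₀, hK₀⟩ := Filter.eventually_atTop.1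
    ((tendsto_pow_const_div_const_pow_of_one_lt c (one_lt_two : (1 : ℝ) < 2)).eventually
      (gt_mem_nhds (show (0 : ℝ) < 1 / 64 by norm_num)))
  refine ⟨max K₀ (2 * c + 8), fun k hk => ?_⟩
  obtain ⟨hk0, hkc⟩ := max_le_iff.1 hk
  have h1 := hK₀ (k + 5) (by omega)
  rw [div_lt_iff₀ (by positivity)] at h1
  have h2 : (((k + 5) ^ c : ℕ) : ℝ) < ((4 * 2 ^ (k - 3) : ℕ) : ℝ) := by
    calc (((k + 5) ^ c : ℕ) : ℝ) = ((k + 5 : ℕ) : ℝ) ^ c := by push_cast; ring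
      _ < 1 / 64 * (2 : ℝ) ^ (k + 5) := h1
      _ = ((4 * 2 ^ (k - 3) : ℕ) : ℝ) := by
        rw [show k + 5 = (k - 3) + 8 by omega, pow_add]; push_cast; ring
  have h3 : (k + 5) ^ c < 4 * 2 ^ (k - 3) := by exact_mod_cast h2
  have h4 : k - 3 < 2 ^ (k - 3) := Nat.lt_two_pow_self
  have h5 : 2 ^ (k + 1) = 16 * 2 ^ (k - 3) := by
    rw [show k + 1 = (k - 3) + 4 by omega, pow_add]; ring
  omega

/-- **No polylogarithmic-space one-pass algorithm, uniform or not, decides `MCSP*[n - 2]`** (the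
partial-function analogue of EVERY conjunct `c` of the door's hypothesis; no time bound). -/
theorem soloInformed_mcspStar_not_polylog_space (c : ℕ) :
    ¬ ∃ A : StreamingAlgorithm, RunsInSpace A (fun N => Nat.log 2 N ^ c + c) ∧
      A.Decides (mcspStarSize fun n => n - 2) := by
  rintro ⟨A, hS, hD⟩
  obtain ⟨K, hK⟩ := exists_two_mul_pow_lt c
  have h := soloInformed_mcspStar_space A hS hD (k := max K 1) (le_max_right _ _)
  have hK' := hK (max K 1) (le_max_left _ _)
  set k := max K 1
  have hlog : Nat.log 2 (15 * 2 ^ (k + 1) + 2) ≤ k + 5 := by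
    refine Nat.le_of_lt_succ (Nat.log_lt_of_lt_pow (by omega) ?_)
    have h32 : 2 ^ (k + 5 + 1) = 2 ^ (k + 1) * 32 := by
      rw [show k + 5 + 1 = (k + 1) + 5 by omega, pow_add]; norm_num
    rw [Nat.succ_eq_add_one, h32]
    have : 1 ≤ 2 ^ (k + 1) := Nat.one_le_two_pow
    omega
  have hmono : Nat.log 2 (15 * 2 ^ (k + 1) + 2) ^ c + c ≤ (k + 5) ^ c + c :=
    Nat.add_le_add_right (Nat.pow_le_pow_left hlog c) c
  omega

/-- In particular `MCSP*[n - 2] ∉ USTREAM[(log₂ N)^c + c, T]` for every `c` and every update-time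
budget `T`: the partial-function twin of the door's hypothesis `StreamingLowerBound` is a theorem. -/
theorem soloInformed_mcspStar_not_mem_USTREAM (c : ℕ) (T : ℕ → ℕ) :
    mcspStarSize (fun n => n - 2) ∉ USTREAM (fun N => Nat.log 2 N ^ c + c) T :=
  fun ⟨A, _, hS, _, _, hD⟩ => soloInformed_mcspStar_not_polylog_space c ⟨A, hS, hD⟩

/-- Monotonicity of the ceiling decider's space in the size function. -/
theorem ceil_space_mono {s s' : ℕ → ℕ} (h : ∀ n, s n ≤ s' n) (N : ℕ) :
    Ceil.space s N ≤ Ceil.space s' N := by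
  unfold Ceil.space
  split_ifs with hP
  · refine min_le_min le_rfl (Nat.succ_le_succ ?_)
    unfold Ceil.width
    refine Nat.succ_le_succ (Nat.log_mono_right (Nat.mul_le_mul_left _ (Nat.succ_le_succ ?_)))
    exact Finset.card_le_card fun g hg => by
      simp only [Ceil.easySet, Finset.mem_filter, Finset.mem_univ, true_and] at hg ⊢
      exact hg.trans (h _)
  · exact le_rfl

/-- **Contrast: total MCSP at the same threshold is decided one-pass in polylogarithmic space**
(`(log₂ N)^3 + 3` bits at every length; the ceiling decider of `SoloInformedStreamingCeiling`). -/
theorem soloInformed_mcspSize_threshold_polylog :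
    ∃ A : StreamingAlgorithm, (∀ N, A.init N = []) ∧
      RunsInSpace A (fun N => Nat.log 2 N ^ 3 + 3) ∧ A.Decides (MCSPSize fun n => n - 2) := by
  obtain ⟨A, h0, hS, hD⟩ := soloInformed_mcspSize_decides_in_space (fun n => n - 2)
  exact ⟨A, h0, fun N x hx => (hS N x hx).trans
    ((ceil_space_mono (fun n => Nat.sub_le n 2) N).trans (space_id_le N)), hD⟩

end Summit.PneNP.PneNP.Theorems
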